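import Summits.HubbardSuperconductivity.HubbardSuperconductivity.Theorems.AnisotropyChordTransferFibre3FinXDCheck

/-!
# Route `AnisotropyChord` / H0 rotor rung: FIN per-`L` row-D (KT-2a″) SUB-CELL facts, `L = 9` (48–53)

Row-D facts `xdCellAny0 9 (49/50) la lb aD = true` on quarter sub-cells of the combined cells whose side condition needs `aD ≈ .04` (mechhunt STATUS p3 g7 REPORT 3).
Prover seat `hubbard-h0-rotor-p3` g7; helper for piece A = stmt-HubbardSuperconductivity-23918 of rung 19089 (`--supports`, helper class).
WHAT THIS IS NOT: nothing here proves superconductivity in the Hubbard model (rotor TARGET as worded stays FALSE, g15 verdict); kernel facts /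
assembly for ONE conditional reduction at one `L`.  No sorry.
-/

set_option linter.dupNamespace false
set_option autoImplicit false

namespace Summit.HubbardSuperconductivity.HubbardSuperconductivity.Theorems.AnisotropyChord.Transfer.Fibre3

namespace FinXD

/-- row-D sub-cell `[14465406650396305, 14555815441961281]` of `L = 9`. [folklore] -/
theorem xd9s_123_0 : xdCellAny0 9 (49/50 : ℚ) 14465406650396305 14555815441961281 (1/25 : ℚ) = true := by decide +kernel

/-- row-D sub-cell `[14555815441961281, 14646224233526258]` of `L = 9`. [folklore] -/
theorem xd9s_123_1 : xdCellAny0 9 (49/50 : ℚ) 14555815441961281 14646224233526258 (1/25 : ℚ) = true := by decide +kernel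

/-- row-D sub-cell `[14646224233526258, 14736633025091234]` of `L = 9`. [folklore] -/
theorem xd9s_123_2 : xdCellAny0 9 (49/50 : ℚ) 14646224233526258 14736633025091234 (1/25 : ℚ) = true := by decide +kernel

/-- row-D sub-cell `[14736633025091234, 14827041816656211]` of `L = 9`. [folklore] -/
theorem xd9s_123_3 : xdCellAny0 9 (49/50 : ℚ) 14736633025091234 14827041816656211 (1/25 : ℚ) = true := by decide +kernel

/-- row-D sub-cell `[14827041816656211, 14919710828010312]` of `L = 9`. [folklore] -/
theorem xd9s_124_0 : xdCellAny0 9 (49/50 : ℚ) 14827041816656211 14919710828010312 (1/25 : ℚ) = true := by decide +kernel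

/-- row-D sub-cell `[14919710828010312, 15012379839364414]` of `L = 9`. [folklore] -/
theorem xd9s_124_1 : xdCellAny0 9 (49/50 : ℚ) 14919710828010312 15012379839364414 (1/25 : ℚ) = true := by decide +kernel

end FinXD

end Summit.HubbardSuperconductivity.HubbardSuperconductivity.Theorems.AnisotropyChord.Transfer.Fibre3
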